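import Literature.MathematicalPhysics.QuantumLattice.GrassmannGaussianMoments
import Literature.MathematicalPhysics.QuantumLattice.FermionQuasiFreeWick
import HarnessLib

/-!
# The equal-time Fock ↔ Grassmann dictionary for quasi-free Gibbs states

Trunk **QLatticeAQFT** / programme under `HubbardFermiLiquid.bgm_two_point_limit`
(Benfatto–Giuliani–Mastropietro 2006).  BGM compute the Schwinger functions of the Hubbard model
through the Grassmann functional-integral representation (2.6)–(2.8) of loc. cit. §2.1, whose
`U = 0` input is that the free fermionic Gibbs state and the "Gaussian Grassmann integration"
`P(dψ)` have the same moments ("Wick rule" with the same propagator, (1.4) = (2.4)).  This file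
proves the equal-time, finite-dimensional core of that statement, joining the two halves already
in the tree:

* Fock side (`FermionQuasiFree*.lean`): for Hermitian `h` and real `β`, the Gibbs state of
  `dΓ(h) = Σ hᵢⱼ c†ᵢ cⱼ` has two-point function `⟨c†ᵣ c_c⟩_β = [(1 + e^{βh})⁻¹]_{c r}`
  (`thermalCorr_dGamma_creation_annihilation`) and nested moments
  `⟨c†_{i₀}⋯c†_{i_{k-1}} c_{j_{k-1}}⋯c_{j₀}⟩_β = det [⟨c†_{iₐ} c_{j_b}⟩]` (`gibbsState_dGamma_nestedWord`);
* Grassmann side (`GrassmannGaussianMoments.lean`): the normalised Gaussian Berezin integral with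
  action `ψ̄ A ψ` has `⟨ψ̄ᵣ ψ_c⟩_A = (A⁻¹)_{c r}` and nested moments `det [(A⁻¹)_{jₐ i_b}]`
  (`grassmannGaussian_twoPoint`, `grassmannGaussian_wick`, `prod_psiBar_mul_prod_psi_rev`).

Hence with `A = 1 + e^{βh}` (invertible: `det_one_add_exp_smul_ne_zero`):

* `thermalCorr_dGamma_eq_grassmannGaussian_twoPoint` —
  `⟨c†ᵣ c_c⟩_β = ∫ e^{ψ̄Aψ} ψ̄ᵣψ_c / ∫ e^{ψ̄Aψ}`;
* `gibbsState_dGamma_nestedWord_eq_grassmannGaussian` —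
  `⟨c†_{i₀}⋯c†_{i_{k-1}} c_{j_{k-1}}⋯c_{j₀}⟩_β = ∫ e^{ψ̄Aψ} ψ̄_{i₀}⋯ψ̄_{i_{k-1}}ψ_{j_{k-1}}⋯ψ_{j₀} / ∫ e^{ψ̄Aψ}`
  for every `k` and every `i j : Fin k → ι` (no injectivity needed: both sides vanish otherwise).

All statements are theorems; no definition or named fact is introduced.

## Sources

G. Benfatto, A. Giuliani, V. Mastropietro, Ann. Henri Poincaré 7 (2006) 809–898, §2.1,
(2.1)–(2.8) (arXiv pp. 5–6 of the held copy `paper:arxiv-cond-mat_0507686`): Grassmann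
representation of the partition function and Schwinger functions, "Standard arguments (see, for
example [NO] …) show that … `Tr e^{-βH}/Tr e^{-βH₀} = lim_M ∫P(dψ) e^{-V(ψ)}`" (2.6) and (2.8).
V. Mastropietro, *Non-Perturbative Renormalization* (World Scientific 2008), Ch. 2 (2.12) (Wick rule
as a determinant) and Ch. 1 (1.48) (fermionic functional integrals for lattice fermions).
M. Gaudin, Nucl. Phys. 15 (1960) 89 (thermal Wick theorem), as in `FermionQuasiFreeWick.lean`.
The equal-time identification proved here is the `M`-independent part of (2.8) at `U = 0`; the
time-dependent statement (Matsubara frequencies, `M → ∞`) is not formalised here.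
-/

noncomputable section

/-! ### The equal-time Fock ↔ Grassmann dictionary for quasi-free Gibbs states -/

namespace Literature.MathematicalPhysics.QuantumLattice

section Dictionary

open NormedSpace Matrix GrassmannAlgebra
open scoped ComplexOrder

variable {ι : Type*} [LinearOrder ι] [Fintype ι]

/-- The matrix `1 + e^{βh}` of the quadratic Grassmann action reproducing the quasi-free Gibbs state
of `dΓ(h)` has non-zero determinant (it is positive definite for Hermitian `h`). [folklore] -/
theorem det_one_add_exp_smul_ne_zero {h : Matrix ι ι ℂ} (hh : h.IsHermitian) (β : ℝ) :
    (1 + exp ((β : ℂ) • h)).det ≠ 0 :=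
  ((posDef_one_add_exp_smul hh β).isUnit.map Matrix.detMonoidHom).ne_zero

/-- **Equal-time Grassmann representation of the quasi-free Gibbs state (two-point function).**
For Hermitian `h` and real `β`, the thermal two-point function of `dΓ(h) = Σ hᵢⱼ c†ᵢ cⱼ` is the
two-point function of the normalised Gaussian Berezin integral with action `ψ̄ (1 + e^{βh}) ψ`:
`⟨c†ᵣ c_c⟩_β = [(1 + e^{βh})⁻¹]_{c r} = ⟨ψ̄ᵣ ψ_c⟩_{1 + e^{βh}}`
(`thermalCorr_dGamma_creation_annihilation` and `grassmannGaussian_twoPoint`; the equal-time,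
`U = 0` content of BGM 2006, (2.8) with (2.3), and of Mastropietro 2008, (1.48)/(2.12)). [folklore] -/
theorem thermalCorr_dGamma_eq_grassmannGaussian_twoPoint {h : Matrix ι ι ℂ} (hh : h.IsHermitian)
    (β : ℝ) (r c : ι) :
    thermalCorr β (dGamma h) (creation r) (annihilation c) =
      berezin ℂ (ι ⊕ₗ ι) (grassmannExp (quadratic ℂ (1 + exp ((β : ℂ) • h))) *
          (psiBar ℂ r * psi ℂ c)) /
        berezin ℂ (ι ⊕ₗ ι) (grassmannExp (quadratic ℂ (1 + exp ((β : ℂ) • h)))) := by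
  rw [thermalCorr_dGamma_creation_annihilation hh,
    grassmannGaussian_twoPoint ℂ _ (det_one_add_exp_smul_ne_zero hh β)]

/-- **Equal-time Grassmann representation of the quasi-free Gibbs state (all nested moments).**
For Hermitian `h`, real `β` and any `i j : Fin k → ι`,
`⟨c†_{i₀} ⋯ c†_{i_{k-1}} c_{j_{k-1}} ⋯ c_{j₀}⟩_β
   = ∫ e^{ψ̄Aψ} ψ̄_{i₀} ⋯ ψ̄_{i_{k-1}} ψ_{j_{k-1}} ⋯ ψ_{j₀} / ∫ e^{ψ̄Aψ}`, `A = 1 + e^{βh}`: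
both sides are the determinant `det [(A⁻¹)_{j_b iₐ}]` (thermal Wick theorem
`gibbsState_dGamma_nestedWord` on the Fock side, `berezin_grassmannExp_quadratic_mul_nested` on the
Grassmann side).  This is the equal-time, `U = 0` case of the Grassmann functional-integral
representation of fermionic Gibbs states (BGM 2006, §2.1, (2.6)–(2.8); Mastropietro 2008, (1.48),
(2.12)). [folklore] -/
theorem gibbsState_dGamma_nestedWord_eq_grassmannGaussian {h : Matrix ι ι ℂ} (hh : h.IsHermitian)
    (β : ℝ) (k : ℕ) (i j : Fin k → ι) :
    gibbsState β (dGamma h) (wordOp (nestedWord k i j)) =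
      berezin ℂ (ι ⊕ₗ ι) (grassmannExp (quadratic ℂ (1 + exp ((β : ℂ) • h))) *
          ((List.ofFn fun a => psiBar ℂ (i a)).prod *
            (List.ofFn fun a => psi ℂ (j (Fin.rev a))).prod)) /
        berezin ℂ (ι ⊕ₗ ι) (grassmannExp (quadratic ℂ (1 + exp ((β : ℂ) • h)))) := by
  set A : Matrix ι ι ℂ := 1 + exp ((β : ℂ) • h) with hA
  have hdet : A.det ≠ 0 := det_one_add_exp_smul_ne_zero hh β
  rw [gibbsState_dGamma_nestedWord hh, prod_psiBar_mul_prod_psi_rev,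
    grassmannGaussian_wick ℂ A hdet i j, ← Matrix.det_transpose]
  congr 1
  ext a b
  simp only [Matrix.transpose_apply, Matrix.of_apply]
  exact thermalCorr_dGamma_creation_annihilation hh β (i b) (j a)

end Dictionary

end Literature.MathematicalPhysics.QuantumLattice
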